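import Summits.ResolutionOfSingularities.ResolutionOfSingularities.Theses.Descent
import Summits.ResolutionOfSingularities.ResolutionOfSingularities.Theses.WeightedInvariant
import Summits.ResolutionOfSingularities.ResolutionOfSingularities.Theses.UniformComplexity
import Literature.AlgebraicGeometry.Resolution.QuasiExcellentSchemes
import Literature.AlgebraicGeometry.Resolution.ResolutionOfComponents

/-!
# Crux `DescentPerfectToAll` (stmt-ResolutionOfSingularities-0549) — line `arc-special-fibre-transversality`

LEAD SKELETON (prover-line-stmt-ResolutionOfSingularities-0549-0, 2026-08-16), rebuilt from the five stub
signatures the crux-plan seat registered on the item (skeleton sha 62e24138…; the planner's own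
`Lines/arc-special-fibre-transversality.lean` never reached the tree — `crux write` refused for that seat — and
the evidence store is not mounted in the lead's jail, so the composition below is re-derived; the stubs are
VERBATIM the registered ones).

The crux: `∀ p prime, PerfectRes p → ResolutionInChar.{0} p`. Composition (`DescentPerfectToAll_of`):

1. `stub_fgModel` — a reduced separated finite-type `X/k` is `X₀ ×_{K₀} k` for a finitely generated subfield
   `K₀ = 𝔽_p(s) ⊆ k` and a reduced separated finite-type `X₀/K₀` (EGA IV₃ 8.8.2 / Stacks 01ZM; in-tree
   Noetherian approximation `Literature.AlgebraicGeometry.Limits.*`).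
2. `stub_closedFibreModels` — THE CORE (uses the antecedent `H`): after a finitely generated enlargement
   `K₀ ≤ L = 𝔽_p(t)`, a proper birational `π : Y → X₀ ×_{K₀} L` which is ROBUST: for every finitely generated
   `L ≤ L' ⊆ k` there are a Noetherian local domain `R` with perfect residue field, `φ : L' → Frac R`, and a proper
   quasi-excellent `𝒴 → Spec R`, regular at the points of its CLOSED fibre, whose generic fibre contains
   `Y ×_L Frac R` as an open (the arc/special-fibre certificate: `R = κ⟦t⟧` for `k = κ((t))`; Cohen/Taylor
   envelopes `b_i ↦ b_i + s_i` into `Frac κ̄⟦s⟧` for general F-finite levels; summit-implied with `R` a local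
   ring of a smooth `𝔽̄_p`-variety with function field `L'·𝔽̄_p`).
3. `stub_propagation` — for `𝒴 → Spec R` proper and quasi-excellent, regularity at the closed fibre propagates to
   all of `𝒴` (Reg is open, EGA IV₂ 7.8.6 / in-tree `Scheme.isOpen_regularLocus_of_isQuasiExcellent`; proper ⇒
   every point specialises into the closed fibre) and to the generic fibre (a localisation).
4. hence `Y ×_L Ω` is regular for an overfield `Ω = Frac R` of every f.g. `L'`; `stub_regularOfFiniteLevels`
   (faithfully flat descent to `Y ×_L L'`, then the Noetherian flat filtered colimit `Y ×_L k = lim Y ×_L L'`: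
   Kunz 1969 / finite Tor-dimension) gives `Y ×_L k` regular.
5. `stub_resolutionOfRobustModel` — base change of the proper birational `π` along `L → k` is proper birational
   with (by 4) regular source: a resolution of `X₀ ×_{K₀} k ≅ X`.

Disproof.lean (v5) honoured: no regular scheme is base-changed along an inseparable extension in the hope that
it stays regular (§3 p68332/p69541, §4 p69878); the antecedent is consumed only inside stub 2 (§2: it must be);
content is imperfect `k`, dim ≥ 4 (§1).

## RESHAPE 1 (lead, 2026-08-16, after wave 1 landed stubs 1, 3, 4, 5 as p74499, p74241, p74947, p74464)

`stub_closedFibreModels` is split at the skeleton level into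
* `stub_levelResolution` — the ANTECEDENT CONSUMER: `PerfectRes p` ⇒ every reduced separated finite-type scheme over a
  FINITELY GENERATED field `L = closure t ⊆ k` of characteristic `p` has a resolution (Disproof §6
  `PerfectToFinitelyGenerated`: spread over an `𝔽_p`-variety with function field `L`, resolve the total space by the
  antecedent, take the generic fibre — provable with the wave-1 machinery: `exists_finiteTypeModel` + SubalgebraDiagram
  descent, `hasResolution_pullback_snd_of_flat`, `isRegular_genericFibre`);
* `stub_robustLevel` — THE CORE, now antecedent-free and certificate-free: given resolutions at every finitely generated
  level, SOME level carries a resolution that stays regular over an overfield of every finitely generated enlargement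
  (summit-implied; crux-complete). The arithmetic certificates of the old stub 2 (proper quasi-excellent `𝒴/R`, regular
  along the closed fibre) remain available to any prover of `stub_robustLevel` through the LANDED `stub_propagation`
  (take `Ω := Frac R`), so nothing of the arc mechanism is lost; it is simply no longer hard-wired into the signature.
The composition is unchanged otherwise: fgModel → robustLevel (fed with levelResolution H) → regularOfFiniteLevels →
resolutionOfRobustModel → `HasResolution.of_iso`.
-/

noncomputable section

set_option linter.dupNamespace false

open CategoryTheory CategoryTheory.Limits AlgebraicGeometry
open Literature.AlgebraicGeometry.Resolution

namespace Summit.ResolutionOfSingularities.ResolutionOfSingularities.Cruxes.DescentPerfectToAll.Lines.ArcSpecialFibreTransversality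

/-! ## The five registered stubs (verbatim signatures) -/

/-- STUB 1 (spreading out): every reduced separated `k`-scheme of finite type is the base change of a reduced
separated scheme of finite type over a finitely generated subfield `K₀ = closure s ⊆ k`.
[cite: EGAIV3, Thm. 8.8.2] -/
theorem stub_fgModel : ∀ (k : Type) [Field k] (X : Scheme.{0}) (f : X ⟶ Spec (.of k)), IsSeparated f → LocallyOfFiniteType f → QuasiCompact f → IsReduced X → ∃ (K₀ : Subfield k) (s : Finset k), K₀ = Subfield.closure (↑s : Set k) ∧ ∃ (X₀ : Scheme.{0}) (f₀ : X₀ ⟶ Spec (.of K₀)), IsSeparated f₀ ∧ LocallyOfFiniteType f₀ ∧ QuasiCompact f₀ ∧ IsReduced X₀ ∧ Nonempty (X ≅ pullback f₀ (Spec.map (CommRingCat.ofHom K₀.subtype))) := by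
  sorry -- LANDED in Theorems/ (see RESHAPE note); restated with sorry only while the farm snapshot is stale

/-- STUB 2a (antecedent consumer — resolution at finitely generated levels): under `PerfectRes p`, every reduced
separated scheme of finite type over a finitely generated field `L = closure t ⊆ k` of characteristic `p` has a
resolution (spreading out over an `𝔽_p`-variety with function field `L`, resolving the total space over the perfect
field `𝔽_p`, generic fibre). [cite: EGAIV3, Thm. 8.8.2] -/
theorem stub_levelResolution : ∀ (p : ℕ) [Fact p.Prime], (∀ (κ : Type) [Field κ] [CharP κ p] [PerfectField κ] (Z : Scheme.{0}) (h : Z ⟶ Spec (.of κ)), IsSeparated h → LocallyOfFiniteType h → QuasiCompact h → IsReduced Z → Scheme.HasResolution Z) → ∀ (k : Type) [Field k] [CharP k p] (L : Subfield k) (t : Finset k), L = Subfield.closure (↑t : Set k) → ∀ (Z : Scheme.{0}) (g : Z ⟶ Spec (.of L)), IsSeparated g → LocallyOfFiniteType g → QuasiCompact g → IsReduced Z → Scheme.HasResolution Z := by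
  sorry

/-- STUB 2b-sep (a robust level when `k` is SEPARABLE over some finitely generated level): if every reduced
separated finite-type scheme over every finitely generated subfield of `k` has a resolution, and `k` is separable
over some finitely generated `L ⊇ K₀` in MacLane's sense (`L`-linearly independent finite families in `k` have
`L`-linearly independent `p`-th powers, i.e. `k ⊗_L L^{1/p}` is reduced — Mathlib's hypothesis in
`exists_isTranscendenceBasis_and_isSeparable_of_linearIndepOn_pow_of_essFiniteType`), then a resolution
`Y → X₀ ×_{K₀} L` at that level (previous stub) is robust: every finitely generated `L ≤ L' ⊆ k` is separably
generated over `L`, so `Y ×_L L'` is regular (purely transcendental then finite separable base change). This is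
Disproof §6 `PerfectToSeparableOverModel`, the maximal sub-case provable by spreading out.
[cite: EGAIV2, Prop. 6.7.4] -/
theorem stub_robustLevelSeparable : ∀ (p : ℕ) [Fact p.Prime] (k : Type) [Field k] [CharP k p], (∀ (L : Subfield k) (t : Finset k), L = Subfield.closure (↑t : Set k) → ∀ (Z : Scheme.{0}) (g : Z ⟶ Spec (.of L)), IsSeparated g → LocallyOfFiniteType g → QuasiCompact g → IsReduced Z → Scheme.HasResolution Z) → ∀ (K₀ : Subfield k) (s : Finset k), K₀ = Subfield.closure (↑s : Set k) → ∀ (X₀ : Scheme.{0}) (f₀ : X₀ ⟶ Spec (.of K₀)), IsSeparated f₀ → LocallyOfFiniteType f₀ → QuasiCompact f₀ → IsReduced X₀ → IsReduced (pullback f₀ (Spec.map (CommRingCat.ofHom K₀.subtype))) → (∃ (L : Subfield k) (_ : K₀ ≤ L) (t : Finset k), L = Subfield.closure (↑t : Set k) ∧ ∀ u : Finset k, LinearIndepOn L _root_.id (↑u : Set k) → LinearIndepOn L (fun x : k => x ^ p) (↑u : Set k)) → ∃ (L : Subfield k) (hL : K₀ ≤ L) (t : Finset k), L = Subfield.closure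 (↑t : Set k) ∧ ∃ (Y : Scheme.{0}) (π : Y ⟶ pullback f₀ (Spec.map (CommRingCat.ofHom (Subfield.inclusion hL)))), IsProper π ∧ IsBirational π ∧ ∀ (L' : Subfield k) (hL' : L ≤ L') (t' : Finset k), L' = Subfield.closure (↑t' : Set k) → ∃ (Ω : Type) (_ : Field Ω) (φ : L' →+* Ω), Scheme.IsRegular (pullback (π ≫ pullback.snd f₀ (Spec.map (CommRingCat.ofHom (Subfield.inclusion hL)))) (Spec.map (CommRingCat.ofHom (φ.comp (Subfield.inclusion hL'))))) := by
  sorry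

/-- STUB 2b-insep (THE CORE — MacLane-obstructed residual): the same conclusion when `k` is separable over NO
finitely generated level above `K₀` (e.g. `k = 𝔽_p((t))` and `trdeg K₀ ≥ 2`: every finitely generated subfield of
transcendence degree ≥ 2 sits inseparably below `k`, MacLane / Disproof §6 `LaurentSeriesCase`). Summit-implied
(descend a resolution of `X₀ ×_{K₀} k` to a finite level); no proof known in print (Temkin 2008, Question 3.3.3).
Tools available to its prover: all landed stubs of this line, in particular `stub_propagation` (arithmetic
certificates `𝒴/R` regular along the closed fibre ⇒ `Ω := Frac R`). -/
theorem stub_robustLevelInseparable : ∀ (p : ℕ) [Fact p.Prime] (k : Type) [Field k] [CharP k p], (∀ (L : Subfield k) (t : Finset k), L = Subfield.closure (↑t : Set k) → ∀ (Z : Scheme.{0}) (g : Z ⟶ Spec (.of L)), IsSeparated g → LocallyOfFiniteType g → QuasiCompact g → IsReduced Z → Scheme.HasResolution Z) → ∀ (K₀ : Subfield k) (s : Finset k), K₀ = Subfield.closure (↑s : Set k) → ∀ (X₀ : Scheme.{0}) (f₀ : X₀ ⟶ Spec (.of K₀)), IsSeparated f₀ → LocallyOfFiniteType f₀ → QuasiCompact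 f₀ → IsReduced X₀ → IsReduced (pullback f₀ (Spec.map (CommRingCat.ofHom K₀.subtype))) → (¬ ∃ (L : Subfield k) (_ : K₀ ≤ L) (t : Finset k), L = Subfield.closure (↑t : Set k) ∧ ∀ u : Finset k, LinearIndepOn L _root_.id (↑u : Set k) → LinearIndepOn L (fun x : k => x ^ p) (↑u : Set k)) → ∃ (L : Subfield k) (hL : K₀ ≤ L) (t : Finset k), L = Subfield.closure (↑t : Set k) ∧ ∃ (Y : Scheme.{0}) (π : Y ⟶ pullback f₀ (Spec.map (CommRingCat.ofHom (Subfield.inclusion hL)))), IsProper π ∧ IsBirational π ∧ ∀ (L' : Subfield k) (hL' : L ≤ L') (t' : Finset k), L' = Subfield.closure (↑t' : Set k) → ∃ (Ω : Type) (_ : Field Ω) (φ : L' →+* Ω), Scheme.IsRegular (pullback (π ≫ pullback.snd f₀ (Spec.map (CommRingCat.ofHom (Subfield.inclusion hL)))) (Spec.map (CommRingCat.ofHom (φ.comp (Subfield.inclusion hL'))))) := by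
  sorry

/-- GLUE (a robust level, by cases on MacLane separability of `k` over the finitely generated levels above `K₀`).
[folklore] -/
theorem robustLevel : ∀ (p : ℕ) [Fact p.Prime] (k : Type) [Field k] [CharP k p], (∀ (L : Subfield k) (t : Finset k), L = Subfield.closure (↑t : Set k) → ∀ (Z : Scheme.{0}) (g : Z ⟶ Spec (.of L)), IsSeparated g → LocallyOfFiniteType g → QuasiCompact g → IsReduced Z → Scheme.HasResolution Z) → ∀ (K₀ : Subfield k) (s : Finset k), K₀ = Subfield.closure (↑s : Set k) → ∀ (X₀ : Scheme.{0}) (f₀ : X₀ ⟶ Spec (.of K₀)), IsSeparated f₀ → LocallyOfFiniteType f₀ → QuasiCompact f₀ → IsReduced X₀ → IsReduced (pullback f₀ (Spec.map (CommRingCat.ofHom K₀.subtype))) → ∃ (L : Subfield k) (hL : K₀ ≤ L) (t : Finset k), L = Subfield.closure (↑t : Set k) ∧ ∃ (Y : Scheme.{0}) (π : Y ⟶ pullback f₀ (Spec.map (CommRingCat.ofHom (Subfield.inclusion hL)))), IsProper π ∧ IsBirational π ∧ ∀ (L' : Subfield k) (hL' : L ≤ L') (t' : Finset k), L' = Subfield.closure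 (↑t' : Set k) → ∃ (Ω : Type) (_ : Field Ω) (φ : L' →+* Ω), Scheme.IsRegular (pullback (π ≫ pullback.snd f₀ (Spec.map (CommRingCat.ofHom (Subfield.inclusion hL)))) (Spec.map (CommRingCat.ofHom (φ.comp (Subfield.inclusion hL'))))) := by
  intro p _ k _ _ hlev K₀ s hK₀ X₀ f₀ h₁ h₂ h₃ h₄ hred
  by_cases hsep : ∃ (L : Subfield k) (_ : K₀ ≤ L) (t : Finset k), L = Subfield.closure (↑t : Set k) ∧
      ∀ u : Finset k, LinearIndepOn L _root_.id (↑u : Set k) → LinearIndepOn L (fun x : k => x ^ p) (↑u : Set k)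
  · exact stub_robustLevelSeparable p k hlev K₀ s hK₀ X₀ f₀ h₁ h₂ h₃ h₄ hred hsep
  · exact stub_robustLevelInseparable p k hlev K₀ s hK₀ X₀ f₀ h₁ h₂ h₃ h₄ hred hsep

/- STUB 3 (`stub_propagation`, propagation of regularity from the closed fibre of a proper quasi-excellent
scheme over a local domain) was LANDED by wave 1 as
`Summit.ResolutionOfSingularities.ResolutionOfSingularities.Theorems.stub_propagation` (p74241,
Theorems/DescentDescentPerfectToAllPropagation.lean). After RESHAPE 1 it is no longer a node of the composition but
the tool by which a prover of `stub_robustLevel` turns an arithmetic certificate (𝒴/R regular along the closed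
fibre) into the overfield `Ω := Frac R` the stub asks for. -/

/-- STUB 4 (regularity at the limit): if a finite-type `Y/L`, `L` finitely generated, becomes regular over SOME
overfield of every finitely generated `L ≤ L' ⊆ k`, then `Y ×_L k` is regular (faithfully flat descent + Kunz /
flat filtered colimits of regular local rings). [cite: Kunz1969, Thm. 2.1] -/
theorem stub_regularOfFiniteLevels : ∀ (k : Type) [Field k] (L : Subfield k) (t : Finset k), L = Subfield.closure (↑t : Set k) → ∀ (Y : Scheme.{0}) (q : Y ⟶ Spec (.of L)), LocallyOfFiniteType q → QuasiCompact q → (∀ (L' : Subfield k) (hL' : L ≤ L') (t' : Finset k), L' = Subfield.closure (↑t' : Set k) → ∃ (Ω : Type) (_ : Field Ω) (φ : L' →+* Ω), Scheme.IsRegular (pullback q (Spec.map (CommRingCat.ofHom (φ.comp (Subfield.inclusion hL')))))) → Scheme.IsRegular (pullback q (Spec.map (CommRingCat.ofHom L.subtype))) := by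
  sorry -- LANDED in Theorems/ (see RESHAPE note); restated with sorry only while the farm snapshot is stale

/-- STUB 5 (base change of the robust model is a resolution): a proper birational `Y → X₀ ×_{K₀} L` whose base
change to `k` is regular yields a resolution of `X₀ ×_{K₀} k`. [folklore] -/
theorem stub_resolutionOfRobustModel : ∀ (k : Type) [Field k] (K₀ L : Subfield k) (hL : K₀ ≤ L) (X₀ : Scheme.{0}) (f₀ : X₀ ⟶ Spec (.of K₀)), IsSeparated f₀ → LocallyOfFiniteType f₀ → QuasiCompact f₀ → ∀ (Y : Scheme.{0}) (π : Y ⟶ pullback f₀ (Spec.map (CommRingCat.ofHom (Subfield.inclusion hL)))), IsProper π → IsBirational π → Scheme.IsRegular (pullback (π ≫ pullback.snd f₀ (Spec.map (CommRingCat.ofHom (Subfield.inclusion hL)))) (Spec.map (CommRingCat.ofHom L.subtype))) → Scheme.HasResolution (pullback f₀ (Spec.map (CommRingCat.ofHom K₀.subtype))) := by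
  sorry -- LANDED in Theorems/ (see RESHAPE note); restated with sorry only while the farm snapshot is stale

/-! ## Composition -/

/-- The line closes the crux modulo its stubs: `DescentPerfectToAll` (route Descent's copy, by name).
[folklore] -/
theorem DescentPerfectToAll_of :
    Summit.ResolutionOfSingularities.ResolutionOfSingularities.Theses.Descent.DescentPerfectToAll := by
  intro p hp H k _ _ X f hsep hlft hqc hred
  haveI : Fact p.Prime := ⟨hp⟩
  -- 1. finitely generated field of definition
  obtain ⟨K₀, s, hK₀, X₀, f₀, h₁, h₂, h₃, h₄, ⟨e⟩⟩ := stub_fgModel k X f hsep hlft hqc hred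
  haveI := hred
  have hredb : IsReduced (pullback f₀ (Spec.map (CommRingCat.ofHom K₀.subtype))) :=
    isReduced_of_isOpenImmersion e.inv
  -- 2a. the antecedent is consumed here: resolutions exist at every finitely generated level
  have hlev := stub_levelResolution p (fun κ _ _ _ Z h a b c d => H κ Z h a b c d) k
  -- 2b. a robust level
  obtain ⟨L, hL, t, hLt, Y, π, hπp, hπb, hrob⟩ :=
    robustLevel p k hlev K₀ s hK₀ X₀ f₀ h₁ h₂ h₃ h₄ hredb
  haveI := h₁; haveI := h₂; haveI := h₃; haveI := hπp
  -- 3. regularity of `Y ×_L k` from the finite levels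
  have hreg : Scheme.IsRegular (pullback (π ≫ pullback.snd f₀ (Spec.map (CommRingCat.ofHom
      (Subfield.inclusion hL)))) (Spec.map (CommRingCat.ofHom L.subtype))) :=
    stub_regularOfFiniteLevels k L t hLt Y _ inferInstance inferInstance hrob
  -- 4. base change of the robust model resolves `X₀ ×_{K₀} k ≅ X`
  exact (stub_resolutionOfRobustModel k K₀ L hL X₀ f₀ h₁ h₂ h₃ Y π hπp hπb hreg).of_iso e.inv

/-- The same proposition for route WeightedInvariant (the three route decls are `rfl`-equal). [folklore] -/
theorem DescentPerfectToAll_of_weightedInvariant :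
    Summit.ResolutionOfSingularities.ResolutionOfSingularities.Theses.WeightedInvariant.DescentPerfectToAll :=
  DescentPerfectToAll_of

/-- The same proposition for route UniformComplexity. [folklore] -/
theorem DescentPerfectToAll_of_uniformComplexity :
    Summit.ResolutionOfSingularities.ResolutionOfSingularities.Theses.UniformComplexity.DescentPerfectToAll :=
  DescentPerfectToAll_of

end Summit.ResolutionOfSingularities.ResolutionOfSingularities.Cruxes.DescentPerfectToAll.Lines.ArcSpecialFibreTransversality

end
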